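import Summits.HodgeConjecture.CorCM.Census.VoronoiStarReduction

/-!
# Base-block covering from a threshold: cover only the blocks of potential `≥ ρ`, leave the near blocks explicit

COR-CM (cell `pub-hodgecm2`), count-neutral kernel combinatorics by the binder seat b09 (gen 38; lane TWO-ADIC SPLITTING +
NONDEGENERATE REDUCTION, part K), sequel of parts C `Census/BaseBlockCovering.lean` and E `Census/VoronoiStarReduction.lean` (`bpot`,
`exists_choice`, `par_cover_self/other`, `bpot_corners_lt`, `descent_of_toward`, `star_of_toward`) used BY NAME.  Theorems only: no definition,
no `decide`, no certificate, no named fact, no `sorry`.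
HONEST FRAMING: `HC_CM` is NOT proved, here or anywhere in the tree; nothing here is a period or a headline.

WHY.  The covering of parts C/E reduces every type to the residual types (potential `≤ 1`) — but through faces chosen by the axiom of choice,
toward SOME nearest base change; where the nearest base change is not unique (ties are the rule at potential `2` near the base block: a double
flip of `T₀` is typically also at distance `2` from a neighbouring base change), a closing argument cannot know how the potential-`2` corners of its
own faces reduce.  The remedy is to cover only from a THRESHOLD `ρ ≥ 2` on (`exists_cover_toward_from`): one face per block of potential `≥ ρ`,
parity-independent with the pivot profile, the `toward` property through every type of potential `≥ ρ`; the finitely many block types of potential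
`< ρ` near the base block (for the quaternion column: the double flips of the standard type, `ρ = 3`) are then covered by EXPLICIT faces of the
closing family, whose corners are known.  The descent and the Voronoi star form of part E (`descent_of_toward`, `star_of_toward`) apply verbatim
to any lattice holding toward-faces through every type of potential `≥ 2` — the union of this familyʼs and the explicit ones (`toward_of_union`).

## References
* [Pohlmann1968] H. Pohlmann, Algebraic cycles on abelian varieties of complex multiplication type, Ann. of Math. 88 (1968), Thm 1.
-/

namespace Summit.HodgeConjecture.CorCM.Census.BaseBlock

open Finset
open Summit.HodgeConjecture.CorCM.Prior.AllgGroup.RfwfAllgGroup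
open Summit.HodgeConjecture.CorCM.Census.BlockParity
open Summit.HodgeConjecture.CorCM.Census.Coinvariant
open Summit.HodgeConjecture.CorCM.Census.TwistGeneration

noncomputable section

variable {G : Type*} [Group G] [Fintype G] [DecidableEq G] (c : G) (T₀ : CMF G c)

/-- **THE COVERING FAMILY FROM A THRESHOLD `ρ ≥ 2`**: EXACTLY one face per block of potential `≥ ρ`, parity-independent with the pivot profile, and
modulo any lattice containing its base changes a face at two deviation places from a NEAREST base change through EVERY type of potential `≥ ρ`;
the blocks of potential `< ρ` are left to an explicit treatment. [folklore] -/
theorem exists_cover_toward_from (hc2 : c * c = 1) (ρ : ℕ) (hρ : 2 ≤ ρ) :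
    ∃ S : Finset (CMF G c →₀ ℤ), (↑S ⊆ gfaceSet G c hc2) ∧
      S.card = (univ.filter fun Bk : Block c => ρ ≤ bpot c T₀ Bk.out).card ∧
      LinearIndepOn (ZMod 2) (fun f : CMF G c →₀ ℤ => par c f) ↑S ∧
      (∀ f ∈ S, ∃ Ψ : CMF G c, ρ ≤ bpot c T₀ Ψ ∧ par c f (blk c Ψ) = 1 ∧
        ∀ B : Block c, B ≠ blk c Ψ → bpot c T₀ Ψ ≤ bpot c T₀ B.out → par c f B = 0) ∧
      ∀ L : Submodule ℤ (CMF G c →₀ ℤ), Submodule.span ℤ (translates c S) ≤ L →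
        ∀ Φ : CMF G c, ρ ≤ bpot c T₀ Φ → ∃ Q t t' : G, bpot c T₀ Φ = ddist (rt c Q T₀) Φ ∧
          t ∈ (rt c Q T₀).1 \ Φ.1 ∧ t' ∈ (rt c Q T₀).1 \ Φ.1 ∧ t ≠ t' ∧ gface c hc2 Φ t t' ∈ L := by
  classical
  have hch : ∀ Bk : Block c, ∃ τ : G × G × G, ρ ≤ bpot c T₀ Bk.out →
      bpot c T₀ Bk.out = ddist (rt c τ.1 T₀) Bk.out ∧
        τ.2.1 ∈ (rt c τ.1 T₀).1 \ Bk.out.1 ∧ τ.2.2 ∈ (rt c τ.1 T₀).1 \ Bk.out.1 ∧ τ.2.1 ≠ τ.2.2 := by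
    intro Bk
    by_cases h : ρ ≤ bpot c T₀ Bk.out
    · obtain ⟨Q, t, t', h1, h3, h4, h5⟩ := exists_choice c T₀ Bk.out (le_trans hρ h)
      exact ⟨(Q, t, t'), fun _ => ⟨h1, h3, h4, h5⟩⟩
    · exact ⟨(1, 1, 1), fun h' => absurd h' h⟩
  choose τ hτ using hch
  set NI : Finset (Block c) := univ.filter fun Bk : Block c => ρ ≤ bpot c T₀ Bk.out with hNI
  set face : Block c → (CMF G c →₀ ℤ) := fun Bk => gface c hc2 Bk.out (τ Bk).2.1 (τ Bk).2.2 with hfaceDef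
  set S : Finset (CMF G c →₀ ℤ) := NI.image face with hS
  have hself : ∀ Bk ∈ NI, par c (face Bk) Bk = 1 := by
    intro Bk hBk
    obtain ⟨h1, h3, h4, h5⟩ := hτ Bk (mem_filter.mp hBk).2
    have h := par_cover_self c T₀ hc2 h1 h3 h4 h5
    rwa [blk_out] at h
  have hother : ∀ Bk ∈ NI, ∀ B : Block c, B ≠ Bk → bpot c T₀ Bk.out ≤ bpot c T₀ B.out → par c (face Bk) B = 0 := by
    intro Bk hBk B hB hle
    obtain ⟨h1, h3, h4, h5⟩ := hτ Bk (mem_filter.mp hBk).2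
    exact par_cover_other c T₀ hc2 h1 h3 h4 h5 (by rw [blk_out]; exact hB) hle
  have hinj : Set.InjOn face ↑NI := by
    intro B₁ hB₁ B₂ hB₂ heq
    by_contra hne
    rcases le_total (bpot c T₀ B₁.out) (bpot c T₀ B₂.out) with hle | hle
    · have h0 := hother B₁ hB₁ B₂ (Ne.symm hne) hle
      rw [heq, hself B₂ hB₂] at h0
      exact one_ne_zero h0
    · have h0 := hother B₂ hB₂ B₁ hne hle
      rw [← heq, hself B₁ hB₁] at h0
      exact one_ne_zero h0
  have hSsub : (↑S : Set (CMF G c →₀ ℤ)) ⊆ gfaceSet G c hc2 := by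
    intro y hy
    obtain ⟨Bk, hBk, rfl⟩ := mem_image.mp (mem_coe.mp hy)
    obtain ⟨-, h3, h4, h5⟩ := hτ Bk (mem_filter.mp hBk).2
    exact ⟨Bk.out, _, _, not_mem_orb_of_mem (mem_sdiff.mp h3).1 (mem_sdiff.mp h4).1 h5, rfl⟩
  refine ⟨S, hSsub, card_image_of_injOn hinj, ?_, ?_, fun L hL Φ hΦ2 => ?_⟩
  · -- parity independence (pivot = own block, rank = potential)
    set p : (CMF G c →₀ ℤ) → Block c := fun f => if h : ∃ Bk ∈ NI, face Bk = f then h.choose else blk c T₀ with hp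
    have hpf : ∀ Bk ∈ NI, p (face Bk) = Bk := by
      intro Bk hBk
      have h : ∃ B ∈ NI, face B = face Bk := ⟨Bk, hBk, rfl⟩
      rw [hp]; simp only [dif_pos h]
      exact hinj h.choose_spec.1 hBk h.choose_spec.2
    rw [LinearIndepOn, linearIndependent_iff']
    intro t g hsum i₁ hi₁
    by_contra hgi₁
    obtain ⟨i₀, hi₀, hmax⟩ := Finset.exists_max_image (t.filter fun i => g i ≠ 0) (fun i => bpot c T₀ (p i.1).out)
      ⟨i₁, mem_filter.mpr ⟨hi₁, hgi₁⟩⟩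
    obtain ⟨hi₀t, hgi₀⟩ := mem_filter.mp hi₀
    obtain ⟨B₀, hB₀, hfB₀⟩ := mem_image.mp i₀.2
    have hp₀ : p i₀.1 = B₀ := by rw [← hfB₀]; exact hpf B₀ hB₀
    have heval := congrFun hsum B₀
    rw [Finset.sum_apply, Pi.zero_apply, Finset.sum_eq_single_of_mem i₀ hi₀t] at heval
    · rw [Pi.smul_apply, smul_eq_mul, ← hfB₀, hself B₀ hB₀, mul_one] at heval
      exact hgi₀ heval
    · intro j hjt hji
      rw [Pi.smul_apply, smul_eq_mul]
      by_cases hgj : g j = 0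
      · rw [hgj, zero_mul]
      · obtain ⟨Bj, hBj, hfBj⟩ := mem_image.mp j.2
        have hpj : p j.1 = Bj := by rw [← hfBj]; exact hpf Bj hBj
        have hlj : bpot c T₀ Bj.out ≤ bpot c T₀ B₀.out := by
          have h := hmax j (mem_filter.mpr ⟨hjt, hgj⟩)
          rwa [hpj, hp₀] at h
        have hne : B₀ ≠ Bj := fun e => hji (Subtype.ext (by rw [← hfBj, ← hfB₀, e]))
        rw [← hfBj, hother Bj hBj B₀ hne hlj, mul_zero]
  · intro f hf
    obtain ⟨Bk, hBk, rfl⟩ := mem_image.mp hf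
    refine ⟨Bk.out, (mem_filter.mp hBk).2, ?_, fun B hB hle => hother Bk hBk B ?_ hle⟩
    · rw [blk_out]; exact hself Bk hBk
    · rw [blk_out] at hB; exact hB
  · -- the translated block face through `Φ` is a face toward a nearest base change
    obtain ⟨Q, hQ⟩ := exists_rt_eq_of_blk_eq c (Quotient.out_eq (blk c Φ) : blk c (blk c Φ).out = blk c Φ)
    have hBNI : blk c Φ ∈ NI := mem_filter.mpr ⟨mem_univ _, by rw [bpot_out]; exact hΦ2⟩
    obtain ⟨h1, h3, h4, h5⟩ := hτ (blk c Φ) (mem_filter.mp hBNI).2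
    set R := (τ (blk c Φ)).1
    set t := (τ (blk c Φ)).2.1
    set t' := (τ (blk c Φ)).2.2
    have hmem : gface c hc2 Φ (t * Q⁻¹) (t' * Q⁻¹) ∈ L := by
      have e : gface c hc2 Φ (t * Q⁻¹) (t' * Q⁻¹) = Finsupp.mapDomain (rt c Q) (face (blk c Φ)) := by
        rw [mapDomain_rt_gface, hQ]
      rw [e]
      exact hL (Submodule.subset_span ⟨Q, _, mem_image_of_mem _ hBNI, rfl⟩)
    have hQ' : bpot c T₀ Φ = ddist (rt c (Q * R) T₀) Φ := by
      rw [← hQ, bpot_rt, rt_mul, ddist_rt]; exact h1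
    have hs : t * Q⁻¹ ∈ (rt c (Q * R) T₀).1 \ Φ.1 := by
      rw [rt_mul, ← hQ, mem_sdiff_rt_iff, inv_mul_cancel_right]; exact h3
    have hs' : t' * Q⁻¹ ∈ (rt c (Q * R) T₀).1 \ Φ.1 := by
      rw [rt_mul, ← hQ, mem_sdiff_rt_iff, inv_mul_cancel_right]; exact h4
    have hss' : t * Q⁻¹ ≠ t' * Q⁻¹ := fun h => h5 (mul_right_cancel h)
    exact ⟨Q * R, t * Q⁻¹, t' * Q⁻¹, hQ', hs, hs', hss', hmem⟩


/-- **Gluing the thresholds**: toward-faces through every type of potential `≥ ρ` (the covering) and through every type of potential in `[2, ρ)`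
(explicit faces) give toward-faces through every type of potential `≥ 2` — the hypothesis of `descent_of_toward` and `star_of_toward`.
[folklore] -/
theorem toward_of_union (hc2 : c * c = 1) (ρ : ℕ) (L : Submodule ℤ (CMF G c →₀ ℤ))
    (hfar : ∀ Φ : CMF G c, ρ ≤ bpot c T₀ Φ → ∃ Q t t' : G, bpot c T₀ Φ = ddist (rt c Q T₀) Φ ∧
      t ∈ (rt c Q T₀).1 \ Φ.1 ∧ t' ∈ (rt c Q T₀).1 \ Φ.1 ∧ t ≠ t' ∧ gface c hc2 Φ t t' ∈ L)
    (hnear : ∀ Φ : CMF G c, 2 ≤ bpot c T₀ Φ → bpot c T₀ Φ < ρ → ∃ Q t t' : G, bpot c T₀ Φ = ddist (rt c Q T₀) Φ ∧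
      t ∈ (rt c Q T₀).1 \ Φ.1 ∧ t' ∈ (rt c Q T₀).1 \ Φ.1 ∧ t ≠ t' ∧ gface c hc2 Φ t t' ∈ L) :
    ∀ Φ : CMF G c, 2 ≤ bpot c T₀ Φ → ∃ Q t t' : G, bpot c T₀ Φ = ddist (rt c Q T₀) Φ ∧
      t ∈ (rt c Q T₀).1 \ Φ.1 ∧ t' ∈ (rt c Q T₀).1 \ Φ.1 ∧ t ≠ t' ∧ gface c hc2 Φ t t' ∈ L := by
  intro Φ hΦ
  by_cases h : ρ ≤ bpot c T₀ Φ
  · exact hfar Φ h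
  · exact hnear Φ hΦ (by omega)

end

end Summit.HodgeConjecture.CorCM.Census.BaseBlock
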